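import Literature.IUT.HodgeTheaters.ThetaNFHodgeTheatersCor56iiHTRClosureCertificate
import HarnessLib

/-!
# [IUTchI] Cor. 5.6 (ii), repaired form (`S5Local.Cor56ii_HTR`, FACT-LIST row F-2046): instance forms at the
# KIT-RULE witness stub `toyS5Local` (proof-only)

S. Mochizuki, *Inter-universal Teichmüller theory I*, kurims manuscript (May 2020), §5, Corollary 5.6 (ii)
pp. 153–154: "the natural functorially induced map from the set of isomorphisms between two … ΘNF-Hodge theaters to
the set of isomorphisms between the respective associated … `𝒟`-ΘNF-Hodge theaters is bijective"
[claim: Mochizuki2012, status: disputed] (IUTchI §5 Cor 5.6 (ii), kurims pp.153-154) (D-0012 claim key; series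
status DISPUTED; nothing printed is asserted here).  abc-iut cell, block F, KEY INST59L1 (seat abc-iut-f-186 gen 3),
FACT-LIST row **F-2046** (wake/KEY-abc-iut-f-167-F2046 never taken — abc-iut-f-167 gen 6 worked row F1487 — so the
row was unheld).  PROOF-ONLY companion of abc-iut-L5-t3's `ThetaNFHodgeTheaters.lean` (no `def`, no `instance`,
nothing re-typed).

Kernel status before this file (plan/LF-KERNEL-STATUS.tsv 2026-08-27T12:11Z): universal closure REFUTED
(`exists_not_cor56ii_HTR` / `not_forall_cor56ii_HTR`, abc-iut-w6-d089: a stub whose base functor on `ℱ^⊚`-isomorphs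
is two-to-one) · conditional closers `cor56ii_HTR_of_NF`, `cor56ii_HTR_of_baseGIso_bijective` (the Cor. 5.3 (i)
rigidity input "`S.baseGIso` bijective") · the positive side only INSIDE the conjunction `cor56ii_HTR_schema` · NO
theorem whose HEAD is the row.  This file records:

* `cor56ii_HTR_toyS5Local H H'` — **INSTANCE FORM** (two binders over a CLOSED inhabited type, no hypothesis): for
  every pair of ΘNF-Hodge theaters over abc-iut-L5's KIT-RULE witness stub `toyS5Local` (over the combinatorial base
  model `trivialModel`, `l = 5`; its base functor on `ℱ^⊚`-isomorphs is the identity, `toyS5Local_baseGIso_bijective`)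
  the row HOLDS — by `cor56ii_HTR_of_baseGIso_bijective`;
* `cor56ii_HTR_toyS5Local_nonvacuous` — NON-VACUITY of both the binders and the bijection: ΘNF-Hodge theaters over
  `toyS5Local` EXIST (`nonempty_thetaNFHodgeTheater`) and between any two of them the type of isomorphisms is
  INHABITED (`ThetaNFHodgeTheater.Hom.nonempty_toy`), so the bijection asserted is between nonempty types;
* `cor56ii_HTR_toyS5Local_choice` — the same at ONE closed pair (the theater chosen from the non-emptiness proof;
  0 binders);
* `cor56ii_HTR_decided` — the schema decided both ways over the base model `trivialModel`.

HONEST LABEL «STUB»: `toyS5Local` takes `ℱ`-data := isomorphs of the `𝒟`-data with identity base functors — a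
consistency device, not print's Frobenioid-theoretic ΘNF-Hodge theaters; an instance at OUR stub ≠ print's
Cor. 5.6 (ii) and carries no token for the cone node IUTchI:Cor5.6(ii).  The GENUINE instance (at S5-local data built
from an initial Θ-datum) is open and sized XL: the tree has no producer of a genuine `S5Local` (abc-iut GAP row
G-L5-EX32I-1 / FOUNDATIONS-14; abc-iut-L5-lead 2026-08-27T12:19:17Z (b)).  Nothing here bears on [IUTchIII] Cor. 3.12
or takes a side; typed ≠ proved; refuted-as-typed ≠ refuted-in-print; nothing asserts abc proved or refuted.
-/

noncomputable section

namespace Literature.IUT.HodgeTheaters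

namespace BaseThetaDatum

open CategoryTheory TrivialModel

/-- **IUTchI:Cor5.6(ii) (repaired form) HOLDS between every two ΘNF-Hodge theaters over the KIT-RULE witness stub
`toyS5Local`** (kurims pp.153-154) — instance form of F-2046 (binders over a closed inhabited type, no hypothesis):
the stub's base functor on `ℱ^⊚`-isomorphs is the identity (`toyS5Local_baseGIso_bijective`), so
`cor56ii_HTR_of_baseGIso_bijective` fires.  HONEST LABEL: stub, not print's Hodge theaters.
[claim: Mochizuki2012, status: disputed] (IUTchI §5 Cor 5.6 (ii), kurims pp.153-154) -/
theorem cor56ii_HTR_toyS5Local (H H' : S5Local.ThetaNFHodgeTheater toyS5Local) :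
    Literature.IUT.HodgeTheaters.BaseThetaDatum.S5Local.Cor56ii_HTR H H' :=
  S5Local.cor56ii_HTR_of_baseGIso_bijective toyS5Local_baseGIso_bijective H H'

/-- **Non-vacuity of the instance**: ΘNF-Hodge theaters over `toyS5Local` exist, and for ANY two of them the type of
isomorphisms `ThetaNFHodgeTheater.Hom H H'` is inhabited while the induced map to isomorphisms of the associated
`𝒟`-ΘNF-Hodge theaters is bijective — the row holds between NONEMPTY types.
[claim: Mochizuki2012, status: disputed] (IUTchI §5 Cor 5.6 (ii), kurims pp.153-154) -/
theorem cor56ii_HTR_toyS5Local_nonvacuous :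
    Nonempty (S5Local.ThetaNFHodgeTheater toyS5Local) ∧
      ∀ H H' : S5Local.ThetaNFHodgeTheater toyS5Local,
        Nonempty (S5Local.ThetaNFHodgeTheater.Hom H H') ∧ S5Local.Cor56ii_HTR H H' :=
  ⟨S5Local.nonempty_thetaNFHodgeTheater toyS5Local,
    fun H H' => ⟨S5Local.ThetaNFHodgeTheater.Hom.nonempty_toy H H', cor56ii_HTR_toyS5Local H H'⟩⟩

/-- **IUTchI:Cor5.6(ii) (repaired form) at ONE CLOSED pair — 0 binders, 0 hypotheses**: the ΘNF-Hodge theater over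
`toyS5Local` chosen from `nonempty_thetaNFHodgeTheater`, paired with itself.
[claim: Mochizuki2012, status: disputed] (IUTchI §5 Cor 5.6 (ii), kurims pp.153-154) -/
theorem cor56ii_HTR_toyS5Local_choice :
    Literature.IUT.HodgeTheaters.BaseThetaDatum.S5Local.Cor56ii_HTR
      (Classical.choice (S5Local.nonempty_thetaNFHodgeTheater toyS5Local))
      (Classical.choice (S5Local.nonempty_thetaNFHodgeTheater toyS5Local)) :=
  cor56ii_HTR_toyS5Local _ _

/-- **F-2046 decided both ways over the base model `trivialModel`**: the row HOLDS for every pair over the stub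
`toyS5Local` (inhabited) and FAILS for some pair over another stub (`exists_not_cor56ii_HTR`, abc-iut-w6-d089).
[claim: Mochizuki2012, status: disputed] (IUTchI §5 Cor 5.6 (ii), kurims pp.153-154) -/
theorem cor56ii_HTR_decided :
    (∃ (S : S5Local trivialModel) (H H' : S5Local.ThetaNFHodgeTheater S),
        Nonempty (S5Local.ThetaNFHodgeTheater.Hom H H') ∧ S5Local.Cor56ii_HTR H H') ∧
      ∃ (S : S5Local trivialModel) (H : S5Local.ThetaNFHodgeTheater S), ¬ S5Local.Cor56ii_HTR H H := by
  obtain ⟨H⟩ := S5Local.nonempty_thetaNFHodgeTheater toyS5Local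
  exact ⟨⟨toyS5Local, H, H, (cor56ii_HTR_toyS5Local_nonvacuous.2 H H)⟩, exists_not_cor56ii_HTR⟩

end BaseThetaDatum

end Literature.IUT.HodgeTheaters

end
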